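/-
Copyright (c) 2026. All rights reserved.
Released under Apache 2.0 license as described in the file LICENSE.
-/
import Mathlib
import HarnessLib

/-!
# Minimum-weight bases of a matroid are the level-tight bases (greedy level criterion)

For a matroid `M` on a finite type and a weight `w : α → ℕ`, write
`levelSet M w θ = {e ∈ M.E | w e ≤ θ}` for the LEVEL SETS of `w`.
* §2 LAYER CAKE (`wt_add_sum_card_level`): `w(B) + Σ_{θ<T} |B ∩ levelSet θ| = T · |B|`, so of two
  bases the one meeting every level set in at least as many elements is lighter
  (`wt_le_of_card_level_le`, strict version `wt_lt_of_card_level_lt`).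
* §3 THE GREEDY BASE (`exists_isBase_forall_isBasis_levelSet`): there is a base meeting EVERY level
  set in a basis of it (a nested chain of bases of the level sets, `greedyChain`).
* §4 THE CRITERION (`forall_isBasis_levelSet_of_min`, `min_of_forall_isBasis_levelSet`): a base `B`
  has minimum weight iff `B ∩ levelSet θ` is an `M`-basis of `levelSet θ` for every `θ` — the
  rank form of the Rado–Edmonds greedy theorem [cite: Schrijver2003, Section 40.1]; hence all
  minimum-weight bases meet each level set in the same number of elements
  (`encard_inter_levelSet_eq_of_min`), i.e. level sets are TIGHT for the family of minimum bases,
  and two elements not separated by any tight set carry the same weight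
  (`weight_eq_of_forall_tight_iff`).
A GENERAL MATROID LEMMA (greedy level criterion, Edmonds 1971) over any `Matroid α` on a
`Fintype` (Mathlib's `Matroid` has no weighted bases); first brick of the UNBUILT rung 2 of the W4
road (GT16 isolation for linear matroid intersection made succinct [cite: GurjarThierauf2017,
Section 3]; blueprint `RUNG2-BLUEPRINT.md` 56dcb5a9…): step (b) of the polytope-free proof of GT16
Lemma 3.9 (zero circulation on the minimum face) from a weight splitting `W = W¹ + W²` (Frank) —
`W²` is constant on the tight-set classes because its level sets are tight. NOTHING about hitting
sets, read-once determinants, VP or VNP is proved here. Currency: helper (O-L2-23), closes no item,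
data defs `levelSet` `greedyChain` `fs` `wt`, no facts/doors, `0` `S`-currency, maths KNOWN.
-/

set_option linter.dupNamespace false

namespace Summit.ValiantsHypothesis.ValiantsHypothesis.Theorems.MatroidMinBaseLevels

open Finset Matroid

variable {α : Type*}

/-! ## §1 Level sets, the layer-cake count, the greedy chain (no finiteness needed) -/

/-- The level set `{e ∈ M.E | w e ≤ θ}`. -/
def levelSet (M : Matroid α) (w : α → ℕ) (θ : ℕ) : Set α := {e | e ∈ M.E ∧ w e ≤ θ}

/-- Level sets lie in the ground set. -/
theorem levelSet_subset_ground (M : Matroid α) (w : α → ℕ) (θ : ℕ) : levelSet M w θ ⊆ M.E :=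
  fun _ he => he.1

/-- Level sets increase with the level. -/
theorem levelSet_mono (M : Matroid α) (w : α → ℕ) {θ θ' : ℕ} (h : θ ≤ θ') :
    levelSet M w θ ⊆ levelSet M w θ' :=
  fun _ he => ⟨he.1, he.2.trans h⟩

/-- Above every weight the level set is the whole ground set. -/
theorem levelSet_eq_ground (M : Matroid α) (w : α → ℕ) {θ : ℕ} (h : ∀ e, w e ≤ θ) :
    levelSet M w θ = M.E :=
  Set.ext fun e => ⟨fun he => he.1, fun he => ⟨he, h e⟩⟩

/-- Layer cake for a finset: `Σ_{e ∈ s} w e = Σ_{θ < T} #{e ∈ s | θ < w e}`. -/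
theorem sum_eq_sum_card_filter_lt (s : Finset α) (w : α → ℕ) {T : ℕ} (hT : ∀ e, w e ≤ T) :
    ∑ e ∈ s, w e = ∑ θ ∈ range T, ((s.filter (fun e => θ < w e)).card : ℕ) := by
  have h1 : ∀ e ∈ s, w e = ∑ θ ∈ range T, (if θ < w e then 1 else 0 : ℕ) := by
    intro e _
    have : (range T).filter (fun θ => θ < w e) = range (w e) := by
      ext θ
      simp only [Finset.mem_filter, Finset.mem_range]
      exact ⟨fun h => h.2, fun h => ⟨lt_of_lt_of_le h (hT e), h⟩⟩
    simp only [Finset.sum_boole, Nat.cast_id, this, card_range]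
  rw [Finset.sum_congr rfl h1, Finset.sum_comm]
  refine Finset.sum_congr rfl fun θ _ => ?_
  simp only [Finset.sum_boole, Nat.cast_id]

/-- The greedy chain: a basis of each level set, each extending the previous one. -/
noncomputable def greedyChain (M : Matroid α) (w : α → ℕ) :
    (θ : ℕ) → {I : Set α // M.IsBasis I (levelSet M w θ)}
  | 0 => ⟨Classical.choose (M.exists_isBasis (levelSet M w 0) (levelSet_subset_ground M w 0)),
      Classical.choose_spec (M.exists_isBasis (levelSet M w 0) (levelSet_subset_ground M w 0))⟩
  | θ + 1 =>
      ⟨Classical.choose ((greedyChain M w θ).2.exists_isBasis_inter_eq_of_superset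
          (levelSet_mono M w (Nat.le_succ θ)) (levelSet_subset_ground M w (θ + 1))),
        (Classical.choose_spec ((greedyChain M w θ).2.exists_isBasis_inter_eq_of_superset
          (levelSet_mono M w (Nat.le_succ θ)) (levelSet_subset_ground M w (θ + 1)))).1⟩

/-- Consecutive members of the greedy chain are nested compatibly with the level sets. -/
theorem greedyChain_succ_inter (M : Matroid α) (w : α → ℕ) (θ : ℕ) :
    (greedyChain M w (θ + 1)).1 ∩ levelSet M w θ = (greedyChain M w θ).1 :=
  (Classical.choose_spec ((greedyChain M w θ).2.exists_isBasis_inter_eq_of_superset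
    (levelSet_mono M w (Nat.le_succ θ)) (levelSet_subset_ground M w (θ + 1)))).2

/-- Every member of the greedy chain is the trace of any later member on its level set. -/
theorem greedyChain_inter_of_le (M : Matroid α) (w : α → ℕ) {θ θ' : ℕ} (h : θ ≤ θ') :
    (greedyChain M w θ').1 ∩ levelSet M w θ = (greedyChain M w θ).1 := by
  induction h with
  | refl => exact Set.inter_eq_self_of_subset_left (greedyChain M w θ).2.subset
  | @step m hle ih =>
      rw [← ih, ← greedyChain_succ_inter M w m, Set.inter_assoc,
        Set.inter_eq_self_of_subset_right (levelSet_mono M w hle)]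

/-! ## §1' Finite bookkeeping: the finset of a set, weights -/

variable [Fintype α] {M : Matroid α} {w : α → ℕ}

open Classical in
/-- The finset of a set of the finite ground type. -/
noncomputable def fs (S : Set α) : Finset α := Finset.univ.filter (fun e => e ∈ S)

/-- Membership in `fs S` is membership in `S`. -/
theorem mem_fs {S : Set α} {e : α} : e ∈ fs S ↔ e ∈ S := by simp [fs]

/-- `fs S` coerces back to `S`. -/
theorem coe_fs (S : Set α) : ((fs S : Finset α) : Set α) = S := by ext e; simp [mem_fs]

/-- The extended cardinality of `S` is the cardinality of `fs S`. -/
theorem encard_eq_card_fs (S : Set α) : S.encard = ((fs S).card : ℕ∞) := by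
  conv_lhs => rw [← coe_fs S]
  exact Set.encard_coe_eq_coe_finsetCard (fs S)

/-- `encard` inequalities transfer to `fs`-cardinalities. -/
theorem card_fs_le_card_fs {S S' : Set α} (h : S.encard ≤ S'.encard) :
    (fs S).card ≤ (fs S').card := by
  rw [encard_eq_card_fs, encard_eq_card_fs] at h
  exact_mod_cast h

/-- `encard` equalities transfer to `fs`-cardinalities. -/
theorem card_fs_eq_card_fs {S S' : Set α} (h : S.encard = S'.encard) :
    (fs S).card = (fs S').card :=
  le_antisymm (card_fs_le_card_fs h.le) (card_fs_le_card_fs h.ge)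

/-- Strict `encard` inequalities transfer to `fs`-cardinalities. -/
theorem card_fs_lt_card_fs {S S' : Set α} (h : S.encard < S'.encard) :
    (fs S).card < (fs S').card := by
  rw [encard_eq_card_fs, encard_eq_card_fs] at h
  exact_mod_cast h

/-- The weight of a set. -/
noncomputable def wt (w : α → ℕ) (S : Set α) : ℕ := ∑ e ∈ fs S, w e

/-- The finset of `B ∩ levelSet θ` is the filter of `fs B` by `w ≤ θ`. -/
theorem fs_inter_levelSet {B : Set α} (hB : B ⊆ M.E) (θ : ℕ) :
    fs (B ∩ levelSet M w θ) = (fs B).filter (fun e => w e ≤ θ) := by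
  ext e
  simp only [mem_fs, Finset.mem_filter, Set.mem_inter_iff, levelSet, Set.mem_setOf_eq]
  exact ⟨fun h => ⟨h.1, h.2.2⟩, fun h => ⟨h.1, hB h.1, h.2⟩⟩

/-! ## §2 Layer cake -/

/-- LAYER CAKE: `w(B) + Σ_{θ < T} |B ∩ levelSet θ| = T · |B|`. -/
theorem wt_add_sum_card_level {B : Set α} (hB : B ⊆ M.E) {T : ℕ} (hT : ∀ e, w e ≤ T) :
    wt w B + ∑ θ ∈ range T, (fs (B ∩ levelSet M w θ)).card = T * (fs B).card := by
  unfold wt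
  rw [sum_eq_sum_card_filter_lt (fs B) w hT, ← Finset.sum_add_distrib]
  have h2 : ∀ θ ∈ range T,
      ((fs B).filter (fun e => θ < w e)).card + (fs (B ∩ levelSet M w θ)).card = (fs B).card := by
    intro θ _
    rw [fs_inter_levelSet hB θ, add_comm]
    have h3 : (fs B).filter (fun e => θ < w e) = (fs B).filter (fun e => ¬ w e ≤ θ) := by
      ext e; simp only [Finset.mem_filter, not_le]
    rw [h3]
    exact Finset.card_filter_add_card_filter_not (s := fs B) (fun e => w e ≤ θ)
  rw [Finset.sum_congr rfl h2, Finset.sum_const, card_range, smul_eq_mul]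

/-- Of two sets of the same size, the one meeting every level set in at least as many elements is
not heavier. -/
theorem wt_le_of_card_level_le {B B' : Set α} (hB : B ⊆ M.E) (hB' : B' ⊆ M.E)
    (hcard : (fs B).card = (fs B').card)
    (hle : ∀ θ, (fs (B' ∩ levelSet M w θ)).card ≤ (fs (B ∩ levelSet M w θ)).card) :
    wt w B ≤ wt w B' := by
  obtain ⟨T, hT⟩ : ∃ T, ∀ e, w e ≤ T :=
    ⟨(Finset.univ : Finset α).sup w, fun e => Finset.le_sup (f := w) (Finset.mem_univ e)⟩
  have h1 := wt_add_sum_card_level (M := M) (w := w) hB hT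
  have h2 := wt_add_sum_card_level (M := M) (w := w) hB' hT
  have h3 : ∑ θ ∈ range T, (fs (B' ∩ levelSet M w θ)).card
      ≤ ∑ θ ∈ range T, (fs (B ∩ levelSet M w θ)).card :=
    Finset.sum_le_sum fun θ _ => hle θ
  rw [hcard] at h1
  generalize T * (fs B').card = K at h1 h2
  omega

/-- Strict version: a strict deficit at one level makes the other set strictly heavier. -/
theorem wt_lt_of_card_level_lt {B B' : Set α} (hB : B ⊆ M.E) (hB' : B' ⊆ M.E)
    (hcard : (fs B).card = (fs B').card)
    (hle : ∀ θ, (fs (B' ∩ levelSet M w θ)).card ≤ (fs (B ∩ levelSet M w θ)).card)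
    {θ₀ : ℕ} (hlt : (fs (B' ∩ levelSet M w θ₀)).card < (fs (B ∩ levelSet M w θ₀)).card) :
    wt w B < wt w B' := by
  obtain ⟨T, hT, hθ₀T⟩ : ∃ T, (∀ e, w e ≤ T) ∧ θ₀ < T :=
    ⟨max ((Finset.univ : Finset α).sup w) (θ₀ + 1),
      fun e => (Finset.le_sup (f := w) (Finset.mem_univ e)).trans (le_max_left _ _),
      lt_of_lt_of_le (Nat.lt_succ_self θ₀) (le_max_right _ _)⟩
  have hθ₀ : θ₀ ∈ range T := Finset.mem_range.2 hθ₀T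
  have h1 := wt_add_sum_card_level (M := M) (w := w) hB hT
  have h2 := wt_add_sum_card_level (M := M) (w := w) hB' hT
  have h3 : ∑ θ ∈ range T, (fs (B' ∩ levelSet M w θ)).card
      < ∑ θ ∈ range T, (fs (B ∩ levelSet M w θ)).card :=
    Finset.sum_lt_sum (fun θ _ => hle θ) ⟨θ₀, hθ₀, hlt⟩
  rw [hcard] at h1
  generalize T * (fs B').card = K at h1 h2
  omega

/-! ## §3 The greedy base -/

/-- THE GREEDY BASE: a base meeting every level set in a basis of it. -/
theorem exists_isBase_forall_isBasis_levelSet (M : Matroid α) (w : α → ℕ) :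
    ∃ B, M.IsBase B ∧ ∀ θ, M.IsBasis (B ∩ levelSet M w θ) (levelSet M w θ) := by
  obtain ⟨T, hT⟩ : ∃ T, ∀ e, w e ≤ T :=
    ⟨(Finset.univ : Finset α).sup w, fun e => Finset.le_sup (f := w) (Finset.mem_univ e)⟩
  have hbas : ∀ θ, θ ≤ T →
      M.IsBasis ((greedyChain M w T).1 ∩ levelSet M w θ) (levelSet M w θ) := by
    intro θ hθ
    rw [greedyChain_inter_of_le M w hθ]
    exact (greedyChain M w θ).2
  have hsub : (greedyChain M w T).1 ⊆ M.E :=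
    (greedyChain M w T).2.subset.trans (levelSet_subset_ground M w T)
  generalize (greedyChain M w T).1 = B at hbas hsub
  have hB : M.IsBase B := by
    have h := hbas T le_rfl
    rw [levelSet_eq_ground M w hT, Set.inter_eq_self_of_subset_left hsub] at h
    exact Matroid.isBasis_ground_iff.1 h
  refine ⟨B, hB, fun θ => ?_⟩
  rcases Nat.lt_or_ge T θ with hθ | hθ
  · have hθ' : ∀ e, w e ≤ θ := fun e => (hT e).trans hθ.le
    rw [levelSet_eq_ground M w hθ', Set.inter_eq_self_of_subset_left hB.subset_ground]
    exact hB.isBasis_ground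
  · exact hbas θ hθ

/-! ## §4 The criterion -/

/-- A base meets a level set in at most as many elements as a basis of that level set. -/
theorem card_inter_levelSet_le {B B' : Set α} (hB' : M.IsBase B') (θ : ℕ)
    (h : M.IsBasis (B ∩ levelSet M w θ) (levelSet M w θ)) :
    (fs (B' ∩ levelSet M w θ)).card ≤ (fs (B ∩ levelSet M w θ)).card := by
  apply card_fs_le_card_fs
  rw [h.encard_eq_eRk]
  exact (hB'.indep.inter_right _).encard_le_eRk_of_subset Set.inter_subset_right

/-- A base meeting every level set in a basis of it has MINIMUM WEIGHT. -/
theorem min_of_forall_isBasis_levelSet {B : Set α} (hB : M.IsBase B)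
    (h : ∀ θ, M.IsBasis (B ∩ levelSet M w θ) (levelSet M w θ)) {B' : Set α} (hB' : M.IsBase B') :
    wt w B ≤ wt w B' :=
  wt_le_of_card_level_le hB.subset_ground hB'.subset_ground
    (card_fs_eq_card_fs (hB.encard_eq_encard_of_isBase hB'))
    fun θ => card_inter_levelSet_le hB' θ (h θ)

/-- A MINIMUM-WEIGHT base meets every level set in a basis of it. -/
theorem forall_isBasis_levelSet_of_min {B : Set α} (hB : M.IsBase B)
    (hmin : ∀ B', M.IsBase B' → wt w B ≤ wt w B') (θ : ℕ) :
    M.IsBasis (B ∩ levelSet M w θ) (levelSet M w θ) := by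
  by_contra hnot
  obtain ⟨Bg, hBg, hg⟩ := exists_isBase_forall_isBasis_levelSet M w
  have hind : M.Indep (B ∩ levelSet M w θ) := hB.indep.inter_right _
  have hne : (B ∩ levelSet M w θ).encard ≠ M.eRk (levelSet M w θ) := by
    intro heq
    exact hnot ((Matroid.isBasis_iff_indep_encard_eq_of_finite (Set.toFinite _)
      (levelSet_subset_ground M w θ)).2 ⟨Set.inter_subset_right, hind, heq⟩)
  have hlt : (fs (B ∩ levelSet M w θ)).card < (fs (Bg ∩ levelSet M w θ)).card := by
    apply card_fs_lt_card_fs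
    rw [(hg θ).encard_eq_eRk]
    exact lt_of_le_of_ne (hind.encard_le_eRk_of_subset Set.inter_subset_right) hne
  have hwt : wt w Bg < wt w B :=
    wt_lt_of_card_level_lt hBg.subset_ground hB.subset_ground
      (card_fs_eq_card_fs (hBg.encard_eq_encard_of_isBase hB))
      (fun θ' => card_inter_levelSet_le hB θ' (hg θ')) hlt
  exact absurd (hmin Bg hBg) (not_le.2 hwt)

/-- All minimum-weight bases meet each level set in the same number of elements: the level sets
are TIGHT for the family of minimum-weight bases. -/
theorem encard_inter_levelSet_eq_of_min {B₁ B₂ : Set α} (hB₁ : M.IsBase B₁) (hB₂ : M.IsBase B₂)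
    (h₁ : ∀ B', M.IsBase B' → wt w B₁ ≤ wt w B') (h₂ : ∀ B', M.IsBase B' → wt w B₂ ≤ wt w B')
    (θ : ℕ) : (B₁ ∩ levelSet M w θ).encard = (B₂ ∩ levelSet M w θ).encard := by
  rw [(forall_isBasis_levelSet_of_min hB₁ h₁ θ).encard_eq_eRk,
    (forall_isBasis_levelSet_of_min hB₂ h₂ θ).encard_eq_eRk]

/-- The minimum weight is attained (there is a minimum-weight base). -/
theorem exists_min_isBase (M : Matroid α) (w : α → ℕ) :
    ∃ B, M.IsBase B ∧ ∀ B', M.IsBase B' → wt w B ≤ wt w B' := by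
  obtain ⟨B, hB, h⟩ := exists_isBase_forall_isBasis_levelSet M w
  exact ⟨B, hB, fun B' hB' => min_of_forall_isBasis_levelSet hB h hB'⟩

/-- Two elements of the ground set that no set TIGHT for the minimum-weight bases separates carry
the same weight (a set `T ⊆ M.E` is tight when every minimum-weight base meets it in a basis of
it). -/
theorem weight_eq_of_forall_tight_iff {e f : α} (he : e ∈ M.E) (hf : f ∈ M.E)
    (h : ∀ T : Set α, T ⊆ M.E →
      (∀ B, M.IsBase B → (∀ B', M.IsBase B' → wt w B ≤ wt w B') → M.IsBasis (B ∩ T) T) →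
      (e ∈ T ↔ f ∈ T)) :
    w e = w f := by
  have htight : ∀ θ, ∀ B, M.IsBase B → (∀ B', M.IsBase B' → wt w B ≤ wt w B') →
      M.IsBasis (B ∩ levelSet M w θ) (levelSet M w θ) :=
    fun θ B hB hmin => forall_isBasis_levelSet_of_min hB hmin θ
  have h1 : f ∈ levelSet M w (w e) :=
    (h _ (levelSet_subset_ground M w (w e)) (htight (w e))).1 ⟨he, le_rfl⟩
  have h2 : e ∈ levelSet M w (w f) :=
    (h _ (levelSet_subset_ground M w (w f)) (htight (w f))).2 ⟨hf, le_rfl⟩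
  exact le_antisymm h2.2 h1.2


end Summit.ValiantsHypothesis.ValiantsHypothesis.Theorems.MatroidMinBaseLevels
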